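import Summits.ABC.ABC.Theses.DefiniteXi
import Literature.NumberTheory.Automorphic.ShimuraCurveRibetTakahashiCokernelProofs
import Literature.NumberTheory.EllipticCurves.RationalTwoTorsionModPIrreducibleProofs
import Literature.NumberTheory.EllipticCurves.NonEisensteinPrimeOfSurjective
import Literature.NumberTheory.EllipticCurves.ModularDegreeMinimal
import Literature.NumberTheory.EllipticCurves.SzpiroFreyConductorProofs
import HarnessLib

/-!
# Stub ideation k=3 · gen 2 (family 3: PROBE THE EXTREMES) — helper statements for
`stub_xiDegreeComparison` of `Cruxes/SteinbergCore/Lines/p6_tamagawa_split.lean`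
(crux stmt-ABC-15024 `SteinbergCore`, route ABC/DefiniteXi).

Scratch only (planner seat).  Every `def … : Prop` is a helper STATEMENT; the `theorem`s record the
assembly `XiOrdLeDegGeneral → XiOrdLeDeg → XiCpsDvdDeg → Sig` (each ≤ 1 prover cycle except the
number-theoretic core `XiOrdLeDegGeneral`, which is ideator k2's H5 chain re-typed in the normal form
the extremal data dictate: ANY curve, ANY definite type, escape clause = Eisenstein prime or `p² ∣ N`),
the numerically certified EXACT law `XiDegreeExactGeneral` (bankable, not on the critical path), and
gen-1's sharp form `XiDegreeComparisonSharp → Sig`.  Sorries mark prover work; nothing here is landed.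
-/

set_option linter.dupNamespace false

noncomputable section

open Literature.NumberTheory.EllipticCurves Literature.NumberTheory.EllipticCurves.ModularForms
open Literature.NumberTheory.Automorphic

namespace Summit.ABC.ABC.Cruxes.SteinbergCore.ProbeExtremesG2

/-- Prime-to-`6` part `n / (2^{v₂ n} 3^{v₃ n})` (the stub spells it out inline; abbreviation only). -/
def cps (n : ℕ) : ℕ := n / (ordProj[2] n * ordProj[3] n)

/-- The registered stub, verbatim (`Lines/p6_tamagawa_split.lean`, `stub_xiDegreeComparison`). -/
def Sig : Prop :=
  ∀ ε : ℝ, 0 < ε → ∃ C : ℝ, ∀ a b : ℤ, IsCoprime a b → a * b * (a + b) ≠ 0 → ∀ (N : ℕ) [NeZero N],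
    (freyCurve a b).conductorNorm ℤ = N →
    ∀ Nm : ℕ, Odd Nm → Squarefree Nm → Odd Nm.primeFactors.card → Nm ∣ N →
    brandtXi (N / Nm) Nm (fun n => (freyCurve a b).LFunction n) ≠ 0 →
    ∃ D : ModularParametrizationData (freyCurve a b) N,
      (∀ D' : ModularParametrizationData (freyCurve a b) N, D.deg ≤ D'.deg) ∧
      ((brandtXi (N / Nm) Nm (fun n => (freyCurve a b).LFunction n) /
          (ordProj[2] (brandtXi (N / Nm) Nm (fun n => (freyCurve a b).LFunction n)) *
            ordProj[3] (brandtXi (N / Nm) Nm (fun n => (freyCurve a b).LFunction n))) : ℕ) : ℝ) ≤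
        C * (N : ℝ) ^ ε * ((D.deg / (ordProj[2] D.deg * ordProj[3] D.deg) : ℕ) : ℝ) *
          ((∏ q ∈ N.primeFactors, ((freyCurve a b).minimalDiscriminantNorm ℤ).factorization q : ℕ) : ℝ) ^ 3

/-! ## H-A  The `C = 1` interface: all slack (`C`, `N^ε`, `T³`) discharged in one lemma -/

/-- **H-A (statement).** Divisibility of prime-to-6 parts, `cps ξ ∣ cps (deg D)` for a minimal datum `D`,
for every Frey curve and every admissible definite type with `ξ ≠ 0`.  Certified numerically far beyond
print's regime (composite `N⁻`, Eichler level `2^e`, on-level primes): jobs j344349 (gen 1), j344519. -/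
def XiCpsDvdDeg : Prop :=
  ∀ a b : ℤ, IsCoprime a b → a * b * (a + b) ≠ 0 → ∀ (N : ℕ) [NeZero N],
    (freyCurve a b).conductorNorm ℤ = N →
    ∀ Nm : ℕ, Odd Nm → Squarefree Nm → Odd Nm.primeFactors.card → Nm ∣ N →
    brandtXi (N / Nm) Nm (fun n => (freyCurve a b).LFunction n) ≠ 0 →
    ∃ D : ModularParametrizationData (freyCurve a b) N,
      (∀ D' : ModularParametrizationData (freyCurve a b) N, D.deg ≤ D'.deg) ∧
      cps (brandtXi (N / Nm) Nm (fun n => (freyCurve a b).LFunction n)) ∣ cps D.deg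

/-- **H-A (lemma, 1 cycle).** `XiCpsDvdDeg → Sig` with `C := 1`: `Nat.le_of_dvd` (`cps (deg D) ≠ 0` from
`D.deg_pos`), `1 ≤ (N:ℝ)^ε` (`Real.one_le_rpow`, `1 ≤ N` from `NeZero`), `1 ≤ T` since every
`q ∈ N.primeFactors` has `0 < v_q(Δ_min)` (`factorization_minimalDiscriminantNorm_pos_of_dvd`, via `hN`),
then `Finset.one_le_prod'`/`one_le_pow₀` and `Nat.cast_le`. -/
theorem sig_of_xiCpsDvdDeg (h : XiCpsDvdDeg) : Sig := by
  sorry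

/-! ## H-B  Primewise form (the induction variable is the prime `p ≥ 5`) -/

/-- **H-B (statement).** `v_p ξ ≤ v_p (deg D)` for every prime `p ≥ 5`. -/
def XiOrdLeDeg : Prop :=
  ∀ a b : ℤ, IsCoprime a b → a * b * (a + b) ≠ 0 → ∀ (N : ℕ) [NeZero N],
    (freyCurve a b).conductorNorm ℤ = N →
    ∀ Nm : ℕ, Odd Nm → Squarefree Nm → Odd Nm.primeFactors.card → Nm ∣ N →
    brandtXi (N / Nm) Nm (fun n => (freyCurve a b).LFunction n) ≠ 0 →
    ∃ D : ModularParametrizationData (freyCurve a b) N,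
      (∀ D' : ModularParametrizationData (freyCurve a b) N, D.deg ≤ D'.deg) ∧
      ∀ p : ℕ, p.Prime → 5 ≤ p →
        (brandtXi (N / Nm) Nm (fun n => (freyCurve a b).LFunction n)).factorization p ≤ D.deg.factorization p

/-- **H-B (lemma, XS).** Primewise `≤` at all `p ≥ 5` ⇒ `cps ∣ cps`: `(cps n).factorization p = n.factorization p`
for `p ≥ 5` and `= 0` at `p = 2, 3` (`Nat.factorization_div`, `Nat.factorization_ordProj…`), then
`Nat.factorization_le_iff_dvd` (`cps ξ ≠ 0`, `cps (deg D) ≠ 0`).  (= ideator k2's H6a', cited not restated.) -/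
theorem xiCpsDvdDeg_of_xiOrdLeDeg (h : XiOrdLeDeg) : XiCpsDvdDeg := by
  sorry

/-! ## H-C  The general-curve normal form with the two escape clauses the extremes exhibit -/

/-- `p` is an **Eisenstein prime** of `W`: `a_ℓ(W) ≡ ℓ + 1 (mod p)` for every good prime `ℓ`
(⇔ `ρ̄_{W,p}` reducible, Chebotarev + Brauer–Nesbitt; the tree's
`exists_prime_not_dvd_lFunction_sub_of_hasIrreducibleModPGaloisRep` is the contrapositive). -/
def IsEisensteinPrime (W : WeierstrassCurve ℚ) (p : ℕ) : Prop :=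
  ∀ ℓ : ℕ, ℓ.Prime → ¬ ℓ ∣ W.conductorNorm ℤ → (p : ℤ) ∣ W.LFunction ℓ - (ℓ + 1)

/-- **H-C (statement) — the number-theoretic core in the shape the data certify.**  For ANY elliptic `W/ℚ`
of conductor `N = N⁺N⁻` (definite type, `gcd = 1`), any minimal datum `D` at level `N`, and any prime
`p ≥ 5` with `p² ∤ N` that is NOT Eisenstein for `W`: `v_p ξ(N⁺,N⁻) ≤ v_p (deg D)`.
Both escape clauses are sharp in the data: Eisenstein `p ∣ i_q` (11a1: `ξ(1;11)=5, deg=1, p=5`;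
26b1 `p=7`; 38b1 `p=5`, …) and `p² ∣ N` (ARS `r_f ≠ deg`; tested in j344519).  This is what ideator k2's
theta-transfer chain (H5 `p^{v_p ξ} ∣ r_f` + ARS Thm 2.1(b)) proves; print (Pollack–Weston Thm 6.8,
Kim–Ota) covers `p ∤ N` only. -/
def XiOrdLeDegGeneral : Prop :=
  ∀ (W : WeierstrassCurve ℚ) [W.IsElliptic] (N Nplus Nminus : ℕ) [NeZero N],
    Nplus * Nminus = N → Nplus.Coprime Nminus → Squarefree Nminus → Odd Nminus.primeFactors.card →
    W.conductorNorm ℤ = N →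
    brandtXi Nplus Nminus (fun n => W.LFunction n) ≠ 0 →
    ∀ D : ModularParametrizationData W N,
      (∀ D' : ModularParametrizationData W N, D.deg ≤ D'.deg) →
      ∀ p : ℕ, p.Prime → 5 ≤ p → ¬ p ^ 2 ∣ N → ¬ IsEisensteinPrime W p →
        (brandtXi Nplus Nminus (fun n => W.LFunction n)).factorization p ≤ D.deg.factorization p

/-- **H-C′ (lemma, XS): Frey curves have no Eisenstein prime `p ≥ 5`** — packaging of the two tree lemmas
`hasIrreducibleModPGaloisRep_freyCurve_of_mazurKenku` (Darmon–Merel Thm 2.2 ⟸ Mazur–Kenku) and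
`exists_prime_not_dvd_lFunction_sub_of_hasIrreducibleModPGaloisRep` (DDT Prop. 2.6(b)). -/
theorem not_isEisensteinPrime_freyCurve (hMK : mazurKenku_exists_cyclic_isogeny) {a b : ℤ}
    (h0 : a * b * (a + b) ≠ 0) {p : ℕ} (hp : p.Prime) (h5 : 5 ≤ p) :
    ¬ IsEisensteinPrime (freyCurve a b) p := by
  haveI := isElliptic_freyCurve h0
  haveI : Fact p.Prime := ⟨hp⟩
  intro hE
  obtain ⟨ℓ, hℓ, -, hℓN, hne⟩ :=
    exists_prime_not_dvd_lFunction_sub_of_hasIrreducibleModPGaloisRep (freyCurve a b) p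
      (hasIrreducibleModPGaloisRep_freyCurve_of_mazurKenku hMK h0 hp h5)
  exact hne (hE ℓ hℓ hℓN)

/-- **H-C″ (lemma, S): Frey specialisation.**  `XiOrdLeDegGeneral → XiOrdLeDeg` given Mazur–Kenku (non-Eisenstein,
H-C′), the route item `FreyModularity` (a minimal datum exists: `exists_minimal_datum`-shape on `deg`) and
`q² ∤ N` for odd `q` (`conductorNorm_freyCurve_dvd_holds : N ∣ 2^8 rad`).  No level cast: `Nplus := N / Nm`,
`Nminus := Nm`, `hM : N / Nm * Nm = N` (`Nat.div_mul_cancel`); coprimality from `Squarefree Nm ∧ q² ∤ N` (odd `q`). -/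
theorem xiOrdLeDeg_of_general (hMK : mazurKenku_exists_cyclic_isogeny)
    (hMod : Summit.ABC.ABC.Theses.DefiniteXi.FreyModularity) (h : XiOrdLeDegGeneral) : XiOrdLeDeg := by
  sorry

/-! ## H-D  The EXACT law (numerically certified; bankable sharper truth, not needed by the stub) -/

/-- **H-D (statement).**  At every non-Eisenstein `p ≥ 5` with `p² ∤ N`:
`v_p (deg D_min) = v_p ξ(N⁺,N⁻) + Σ_{q ∣ N⁻} v_p (v_q Δ_min)` (GEOMETRIC component orders `v_q(Δ_min)`, not
Tamagawa numbers).  Prime type: Takahashi 2001 Thm 2.3 (`δ i = ξ j`, `i j = v_q Δ`) + Edixhoven 1991 (component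
groups of `J₀(N)` Eisenstein ⇒ `p ∤ i`); composite type: beyond print (cokernels `j_q` of the Shimura-curve
telescope, Pasten 2024 Thm 6.17) — the data decide it in range. -/
def XiDegreeExactGeneral : Prop :=
  ∀ (W : WeierstrassCurve ℚ) [W.IsElliptic] (N Nplus Nminus : ℕ) [NeZero N],
    Nplus * Nminus = N → Nplus.Coprime Nminus → Squarefree Nminus → Odd Nminus.primeFactors.card →
    W.conductorNorm ℤ = N →
    brandtXi Nplus Nminus (fun n => W.LFunction n) ≠ 0 →
    ∀ D : ModularParametrizationData W N,
      (∀ D' : ModularParametrizationData W N, D.deg ≤ D'.deg) →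
      ∀ p : ℕ, p.Prime → 5 ≤ p → ¬ p ^ 2 ∣ N → ¬ IsEisensteinPrime W p →
        D.deg.factorization p =
          (brandtXi Nplus Nminus (fun n => W.LFunction n)).factorization p +
            ∑ q ∈ Nminus.primeFactors, ((W.minimalDiscriminantNorm ℤ).factorization q).factorization p

/-- **H-D′ (XS).** The exact law implies the inequality core. -/
theorem xiOrdLeDegGeneral_of_exact (h : XiDegreeExactGeneral) : XiOrdLeDegGeneral := by
  intro W _ N Nplus Nminus _ hM hcop hsq hodd hN hxi D hmin p hp h5 hsqN hE
  rw [h W N Nplus Nminus hM hcop hsq hodd hN hxi D hmin p hp h5 hsqN hE]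
  exact Nat.le_add_right _ _

/-! ## H-E  gen-1's sharp form (carried forward; the `hchain` step of `xiDegreeComparison_of_facts`) -/

/-- **H-E (statement, gen 1 H4).** `cps ξ ≤ 163^{ω(Nm)} · ∏_{q ∣ Nm} v_q(Δ_min) · cps (deg D)` — `T`-exponent one and
only the primes of `Nm`: the form the Takahashi/Ribet–Takahashi/Pasten chain actually yields (p139336). -/
def XiDegreeComparisonSharp : Prop :=
  ∀ a b : ℤ, IsCoprime a b → a * b * (a + b) ≠ 0 → ∀ (N : ℕ) [NeZero N],
    (freyCurve a b).conductorNorm ℤ = N →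
    ∀ Nm : ℕ, Odd Nm → Squarefree Nm → Odd Nm.primeFactors.card → Nm ∣ N →
    brandtXi (N / Nm) Nm (fun n => (freyCurve a b).LFunction n) ≠ 0 →
    ∃ D : ModularParametrizationData (freyCurve a b) N,
      (∀ D' : ModularParametrizationData (freyCurve a b) N, D.deg ≤ D'.deg) ∧
      cps (brandtXi (N / Nm) Nm (fun n => (freyCurve a b).LFunction n)) ≤
        163 ^ Nm.primeFactors.card *
          (∏ q ∈ Nm.primeFactors, ((freyCurve a b).minimalDiscriminantNorm ℤ).factorization q) * cps D.deg

/-- **H-E′ (lemma, ½ cycle, gen 1 H5).** `C := ` the constant of `exists_pow_card_primeFactors_le hε`-type absorption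
`163^{ω(Nm)} ≤ C N^ε` (`Nm ≤ N`), `∏_{q∣Nm} v_q ≤ ∏_{q∣N} v_q ≤ T³` (factors `≥ 1`,
`Finset.prod_le_prod_of_subset_of_one_le'`, `le_self_pow`). -/
theorem sig_of_sharp (h : XiDegreeComparisonSharp) : Sig := by
  sorry

/-! ## Assembly -/

/-- The stub from the general core (modulo Mazur–Kenku and the route item `FreyModularity`). -/
theorem sig_of_general (hMK : mazurKenku_exists_cyclic_isogeny)
    (hMod : Summit.ABC.ABC.Theses.DefiniteXi.FreyModularity) (h : XiOrdLeDegGeneral) : Sig :=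
  sig_of_xiCpsDvdDeg (xiCpsDvdDeg_of_xiOrdLeDeg (xiOrdLeDeg_of_general hMK hMod h))

end Summit.ABC.ABC.Cruxes.SteinbergCore.ProbeExtremesG2

end
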